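import Literature.MathematicalPhysics.QuantumFieldTheory.Balaban1983to89.B12Rep526Coeff
import Literature.Analysis.Complex.LocallyUniformLimitSCV

/-!
# `Balaban1983to89.B12Rep526Analytic` — [Balaban1987RG1] §5 p. 294: «The functions f_{μν}(z) are analytic on the
polyring ×_μ{e^{−δ₁} < |z_μ| < e^{δ₁}}» and «the functions g^ε_{μν}(z) are analytic on the polydisc ×_μ{|z_μ| < e^{δ₁}}»
— the `AnalyticOnNhd ℂ` packaging of (5.17)/(5.29) and of the pieces (5.22) of `B12Rep526Coeff`, PROVED

HONEST FRAMING (cell `lit-balaban`, verbatim): statement-level skeleton of published theorems with citation tags;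
proofs where landed; nothing here is a claim about the Yang–Mills mass gap.

CITATION HEADER.  T. Bałaban, *Renormalization group approach to lattice gauge field theories. I. Generation of
effective actions in a small field approximation and a coupling constant renormalization in four dimensions*,
Commun. Math. Phys. **109** (1987) 249–301, doi:10.1007/bf01215223 [Balaban1987RG1] (cell paper B12).
PDF held: `paper:balaban1987-cmp109-rg-i-small-field` (journal page = PDF page + 248; p. 294 read as an image from
the page render `b2b-balaban-ref1/pages/1987-cmp109-rg-I-small-field/…-p046-x2.png`).  Unit `lit-balaban-r09` gen 3,
HOME `run/shared/lean/pub/lit-balaban/`; WHAT IS REPRODUCED = the last clause of SKELETON row `B12.Eq5.22-5.26` left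
open by `B12Rep526Coeff` (its header: «the `AnalyticOnNhd` packaging in `d` variables is not done here» — there
«analytic» was represented by absolute convergence of the power / Laurent series on closed sub-polydiscs /
sub-poly-annuli: `summable_norm_piece`, `norm_summand_piece_le`, `summable_norm_f529`).  Imported BY NAME (nothing
re-declared): `B12Rep526Coeff.f529/piece/gRep/wgt/flipPt/PolyDisc/norm_summand_piece_le/exponent_nonneg_of_wgt_ne_zero`,
`PeriodicGleason.zpowv/ExpBound/wt/l1/PolyAnnulus/norm_zpowv_le/summable_wt`, and the tree's several-complex-variables
Weierstrass theorem `Literature.Analysis.Complex.SCV.analyticOnNhd_tsum_of_summable_norm` ([HormanderSCV1973] §2.2: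
a normally convergent series of holomorphic maps on an open set of a finite-dimensional complex space is analytic).

WHAT IS PRINTED (verbatim, p. 294).  (5.17) *«f_{μν}(z₁,…,z_d) = Π_{μν}((1/i) log z₁, …, (1/i) log z_d),
e^{−δ₁} < |z_μ| < e^{δ₁}, … The functions f_{μν}(z) are analytic on the polyring ×_μ{e^{−δ₁} < |z_μ| < e^{δ₁}},
and the properties (5.12)–(5.15) imply the following ones»*; after (5.22): *«where the functions g^ε_{μν}(z) are
analytic on the polydisc ×_μ{|z_μ| < e^{δ₁}}.»*  The decay rate `δ₁` is that of (5.10) p. 293 («|Π_{μν}(x − y)| ≤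
O(1)E₀ exp(−δ₁|x − y|)»), typed as `ExpBound δ₁ M (Π_{μν})` (ℓ¹ distance, as in `B12Rep537`/`B12Transverse536`).

WHAT IS PROVED (kernel-checked; `a` = the decay rate, `M` = the constant of `ExpBound a M (c μ ν)`).
* `OpenPolyDisc d b = {w | ∀ j, |w_j| < e^b}`, `OpenPolyAnnulus d b = {z | ∀ j, e^{−b} < |z_j| < e^b}` (both open).
* **`analyticOnNhd_piece`** / **`analyticOnNhd_gRep`**: every piece `g^ε_{μν}` of (5.22), in particular `g_{μν}`, is
  analytic on the open polydisc of radius `e^a` — THE PRINTED POLYDISC for `a = δ₁`.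
* **`analyticOnNhd_f529`**: `f_{μν}` = (5.29) is analytic on the open polyring `e^{−a} < |z_j| < e^{a}` — THE PRINTED
  POLYRING for `a = δ₁`.
Method: on every open sub-polydisc / sub-polyring of width `b < a` the series is a normally convergent series of
holomorphic monomial terms (bounds `M e^{−(a−b)|x|₁}` from `B12Rep526Coeff` / `PeriodicGleason`), hence analytic there
by the imported Weierstrass theorem; every point of the width-`a` region lies in some width-`b` region, `b < a`
(`exists_exp_between`).  No `Prop` fact; axioms standard.
-/

namespace Literature.MathematicalPhysics.QuantumFieldTheory.Balaban1983to89.B12Rep526Analytic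

noncomputable section

open Literature.MathematicalPhysics.QuantumFieldTheory.GawedzkiKupiainen1985.PeriodicGleason
open Literature.MathematicalPhysics.QuantumFieldTheory.Balaban1983to89.B12Rep526
open Literature.MathematicalPhysics.QuantumFieldTheory.Balaban1983to89.B12Rep526Coeff
open Finset

variable {d : ℕ}

/-! ## §1. The open polydisc and the open polyring -/

/-- The open polydisc `×_j{|w_j| < e^b}` («the polydisc ×_μ{|z_μ| < e^{δ₁}}» for `b = δ₁`).
[cite: Balaban1987RG1, (5.22) p.294] -/
def OpenPolyDisc (d : ℕ) (b : ℝ) : Set (Fin d → ℂ) := {w | ∀ j, ‖w j‖ < Real.exp b}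

/-- The open polyring `×_j{e^{−b} < |z_j| < e^b}` («the polyring ×_μ{e^{−δ₁} < |z_μ| < e^{δ₁}}» for `b = δ₁`).
[cite: Balaban1987RG1, (5.17) p.294] -/
def OpenPolyAnnulus (d : ℕ) (b : ℝ) : Set (Fin d → ℂ) :=
  {z | ∀ j, Real.exp (-b) < ‖z j‖ ∧ ‖z j‖ < Real.exp b}

/-- The open polydisc is open. [cite: Balaban1987RG1, (5.22) p.294] -/
theorem isOpen_openPolyDisc (d : ℕ) (b : ℝ) : IsOpen (OpenPolyDisc d b) := by
  have : OpenPolyDisc d b = ⋂ j, {w : Fin d → ℂ | ‖w j‖ < Real.exp b} := by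
    ext w; simp [OpenPolyDisc]
  rw [this]
  exact isOpen_iInter_of_finite fun j =>
    isOpen_lt (continuous_norm.comp (continuous_apply j)) continuous_const

/-- The open polyring is open. [cite: Balaban1987RG1, (5.17) p.294] -/
theorem isOpen_openPolyAnnulus (d : ℕ) (b : ℝ) : IsOpen (OpenPolyAnnulus d b) := by
  have : OpenPolyAnnulus d b
      = ⋂ j, ({z : Fin d → ℂ | Real.exp (-b) < ‖z j‖} ∩ {z : Fin d → ℂ | ‖z j‖ < Real.exp b}) := by
    ext z; simp [OpenPolyAnnulus]
  rw [this]
  exact isOpen_iInter_of_finite fun j =>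
    (isOpen_lt continuous_const (continuous_norm.comp (continuous_apply j))).inter
      (isOpen_lt (continuous_norm.comp (continuous_apply j)) continuous_const)

/-- The open polydisc of radius `e^b` lies in the closed one (`B12Rep526Coeff.PolyDisc`).
[cite: Balaban1987RG1, (5.22) p.294] -/
theorem polyDisc_of_openPolyDisc {b : ℝ} {w : Fin d → ℂ} (hw : w ∈ OpenPolyDisc d b) : w ∈ PolyDisc d b :=
  fun j => (hw j).le

/-- The open polyring of width `b` lies in the closed one (`PeriodicGleason.PolyAnnulus`).
[cite: Balaban1987RG1, (5.17) p.294] -/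
theorem polyAnnulus_of_openPolyAnnulus {b : ℝ} {z : Fin d → ℂ} (hz : z ∈ OpenPolyAnnulus d b) :
    z ∈ PolyAnnulus d b :=
  fun j => ⟨(hz j).1.le, (hz j).2.le⟩

/-- Finitely many reals below `e^a` are below some `e^b`, `b < a` (every point of the width-`a` region lies in a
width-`b` sub-region). [folklore] -/
private theorem exists_exp_between {ι : Type*} [Fintype ι] {a : ℝ} (r : ι → ℝ) (hr : ∀ i, r i < Real.exp a) :
    ∃ b, b < a ∧ ∀ i, r i < Real.exp b := by
  classical
  by_cases hι : Nonempty ι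
  · haveI := hι
    set t := Finset.univ.sup' Finset.univ_nonempty r with ht_def
    have ht : t < Real.exp a := (Finset.sup'_lt_iff _).mpr fun i _ => hr i
    set t' := max t (Real.exp (a - 1)) with ht'_def
    have ht'pos : 0 < t' := lt_max_of_lt_right (Real.exp_pos _)
    have ht'a : t' < Real.exp a := max_lt ht (Real.exp_lt_exp.mpr (by linarith))
    have hlog : Real.log t' < a := (Real.log_lt_iff_lt_exp ht'pos).mpr ht'a
    refine ⟨(Real.log t' + a) / 2, by linarith, fun i => ?_⟩
    calc r i ≤ t := Finset.le_sup' r (Finset.mem_univ i)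
      _ ≤ t' := le_max_left _ _
      _ = Real.exp (Real.log t') := (Real.exp_log ht'pos).symm
      _ < Real.exp ((Real.log t' + a) / 2) := Real.exp_lt_exp.mpr (by linarith)
  · exact ⟨a - 1, by linarith, fun i => (hι ⟨i⟩).elim⟩

/-- Every point of the open polydisc of radius `e^a` lies in an open polydisc of radius `e^b`, `b < a`.
[cite: Balaban1987RG1, (5.22) p.294] -/
theorem exists_openPolyDisc_lt {a : ℝ} {w : Fin d → ℂ} (hw : w ∈ OpenPolyDisc d a) :
    ∃ b, b < a ∧ w ∈ OpenPolyDisc d b :=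
  exists_exp_between (fun j => ‖w j‖) hw

/-- Every point of the open polyring of width `a` lies in an open polyring of width `b`, `b < a`.
[cite: Balaban1987RG1, (5.17) p.294] -/
theorem exists_openPolyAnnulus_lt {a : ℝ} {z : Fin d → ℂ} (hz : z ∈ OpenPolyAnnulus d a) :
    ∃ b, b < a ∧ z ∈ OpenPolyAnnulus d b := by
  -- the norms and the inverse norms are all below `e^a`
  have hpos : ∀ j, 0 < ‖z j‖ := fun j => (Real.exp_pos _).trans (hz j).1
  obtain ⟨b, hba, hb⟩ := exists_exp_between (a := a)
    (Sum.elim (fun j => ‖z j‖) (fun j => ‖z j‖⁻¹)) (by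
      rintro (j | j)
      · exact (hz j).2
      · simp only [Sum.elim_inr]
        calc ‖z j‖⁻¹ < (Real.exp (-a))⁻¹ := (inv_lt_inv₀ (hpos j) (Real.exp_pos _)).mpr (hz j).1
          _ = Real.exp a := by rw [Real.exp_neg, inv_inv])
  refine ⟨b, hba, fun j => ⟨?_, by simpa using hb (Sum.inl j)⟩⟩
  have h2 : ‖z j‖⁻¹ < Real.exp b := by simpa using hb (Sum.inr j)
  have : (Real.exp b)⁻¹ < ‖z j‖ := by
    rw [← inv_inv ‖z j‖]
    exact (inv_lt_inv₀ (Real.exp_pos _) (inv_pos.mpr (hpos j))).mpr h2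
  rwa [← Real.exp_neg] at this

/-! ## §2. Monomials are holomorphic -/

/-- A monomial with non-negative exponents is complex-differentiable everywhere. [folklore] -/
private theorem differentiableOn_zpowv_of_nonneg {m : Pt d} (hm : ∀ κ, 0 ≤ m κ) (s : Set (Fin d → ℂ)) :
    DifferentiableOn ℂ (fun w : Fin d → ℂ => zpowv w m) s := by
  classical
  unfold zpowv
  intro z hz
  exact (HasFDerivWithinAt.finsetProd (u := Finset.univ) fun κ _ =>
    (((differentiableAt_apply (𝕜 := ℂ) κ z).zpow (Or.inr (hm κ))).hasFDerivAt.hasFDerivWithinAt)).differentiableWithinAt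

/-- A monomial with arbitrary integer exponents is complex-differentiable where no coordinate vanishes. [folklore] -/
private theorem differentiableOn_zpowv_of_ne_zero (m : Pt d) {s : Set (Fin d → ℂ)}
    (hs : ∀ z ∈ s, ∀ κ, z κ ≠ 0) : DifferentiableOn ℂ (fun w : Fin d → ℂ => zpowv w m) s := by
  classical
  unfold zpowv
  intro z hz
  exact (HasFDerivWithinAt.finsetProd (u := Finset.univ) fun κ _ =>
    (((differentiableAt_apply (𝕜 := ℂ) κ z).zpow (Or.inl (hs z hz κ))).hasFDerivAt.hasFDerivWithinAt)).differentiableWithinAt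

/-- Every summand of a piece `g^ε` is an entire function of `w` (a weighted monomial with non-negative exponents, or
zero). [cite: Balaban1987RG1, (5.22) p.294] -/
theorem differentiableOn_summand_piece (c : Fin d → Fin d → Pt d → ℂ) (μ ν : Fin d) (ε : Fin d → ℤˣ) (x : Pt d)
    (s : Set (Fin d → ℂ)) :
    DifferentiableOn ℂ (fun w : Fin d → ℂ => (wgt μ ν ε x : ℂ) * (c μ ν x * zpowv w (-flipPt ε x))) s := by
  by_cases h0 : wgt μ ν ε x = 0
  · have : (fun w : Fin d → ℂ => (wgt μ ν ε x : ℂ) * (c μ ν x * zpowv w (-flipPt ε x))) = fun _ => 0 := by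
      funext w; rw [h0, Complex.ofReal_zero, zero_mul]
    rw [this]
    exact differentiableOn_const _
  · exact ((differentiableOn_zpowv_of_nonneg (exponent_nonneg_of_wgt_ne_zero h0) s).const_mul _).const_mul _

/-- Every summand of (5.29) is holomorphic on a set where no coordinate vanishes.
[cite: Balaban1987RG1, (5.29) p.295] -/
theorem differentiableOn_summand_f529 (c : Fin d → Fin d → Pt d → ℂ) (μ ν : Fin d) (x : Pt d)
    {s : Set (Fin d → ℂ)} (hs : ∀ z ∈ s, ∀ κ, z κ ≠ 0) :
    DifferentiableOn ℂ (fun z : Fin d → ℂ => c μ ν x * zpowv z (-x)) s :=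
  (differentiableOn_zpowv_of_ne_zero (-x) hs).const_mul _

/-! ## §3. «the functions g^ε_{μν}(z) are analytic on the polydisc» -/

/-- Each piece `g^ε_{μν}` is analytic on every open polydisc of radius `e^b`, `b < a` (normally convergent series of
entire terms, Weierstrass). [cite: Balaban1987RG1, (5.22) p.294] -/
theorem analyticOnNhd_piece_of_lt {a M : ℝ} {c : Fin d → Fin d → Pt d → ℂ} {μ ν : Fin d}
    (hc : ExpBound a M (c μ ν)) (ε : Fin d → ℤˣ) {b : ℝ} (hab : b < a) :
    AnalyticOnNhd ℂ (piece c μ ν ε) (OpenPolyDisc d b) :=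
  Literature.Analysis.Complex.SCV.analyticOnNhd_tsum_of_summable_norm (isOpen_openPolyDisc d b)
    (fun x => differentiableOn_summand_piece c μ ν ε x _) ((summable_wt (by linarith) d).mul_left M)
    fun x w hw => norm_summand_piece_le hc ε (polyDisc_of_openPolyDisc hw) x

/-- **«the functions g^ε_{μν}(z) are analytic on the polydisc ×_μ{|z_μ| < e^{δ₁}}»** — for a kernel with the decay
(5.10) at rate `a` (`= δ₁`), every piece of (5.22) is analytic on the open polydisc of radius `e^a`.
[cite: Balaban1987RG1, (5.22) p.294] -/
theorem analyticOnNhd_piece {a M : ℝ} {c : Fin d → Fin d → Pt d → ℂ} {μ ν : Fin d}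
    (hc : ExpBound a M (c μ ν)) (ε : Fin d → ℤˣ) : AnalyticOnNhd ℂ (piece c μ ν ε) (OpenPolyDisc d a) := by
  intro w hw
  obtain ⟨b, hba, hwb⟩ := exists_openPolyDisc_lt hw
  exact analyticOnNhd_piece_of_lt hc ε hba w hwb

/-- In particular `g_{μν} = g^{(+1,…,+1)}_{μν}` is analytic on the polydisc of radius `e^a`.
[cite: Balaban1987RG1, (5.26) p.295] -/
theorem analyticOnNhd_gRep {a M : ℝ} {c : Fin d → Fin d → Pt d → ℂ} {μ ν : Fin d}
    (hc : ExpBound a M (c μ ν)) : AnalyticOnNhd ℂ (gRep c μ ν) (OpenPolyDisc d a) :=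
  analyticOnNhd_piece hc 1

/-! ## §4. «The functions f_{μν}(z) are analytic on the polyring» -/

/-- `|x|₁` is even. [folklore] -/
private theorem l1_neg (x : Pt d) : l1 (-x) = l1 x := by
  simp [l1]

/-- The summands of (5.29) are bounded by `M e^{−(a−b)|x|₁}` on the open polyring of width `b`.
[cite: Balaban1987RG1, (5.29) p.295] -/
theorem norm_summand_f529_le {a M : ℝ} {c : Fin d → Fin d → Pt d → ℂ} {μ ν : Fin d}
    (hc : ExpBound a M (c μ ν)) {b : ℝ} {z : Fin d → ℂ} (hz : z ∈ OpenPolyAnnulus d b) (x : Pt d) :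
    ‖c μ ν x * zpowv z (-x)‖ ≤ M * wt (a - b) x := by
  rw [norm_mul]
  calc ‖c μ ν x‖ * ‖zpowv z (-x)‖ ≤ (M * wt a x) * Real.exp (b * l1 (-x)) :=
        mul_le_mul (hc x) (norm_zpowv_le (polyAnnulus_of_openPolyAnnulus hz) (-x)) (norm_nonneg _)
          (mul_nonneg hc.nonneg (wt_pos a x).le)
    _ = M * wt (a - b) x := by
        rw [l1_neg, wt, wt, mul_assoc, ← Real.exp_add]
        congr 2
        ring

/-- `f_{μν}` is analytic on every open polyring of width `b < a`. [cite: Balaban1987RG1, (5.17) p.294] -/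
theorem analyticOnNhd_f529_of_lt {a M : ℝ} {c : Fin d → Fin d → Pt d → ℂ} {μ ν : Fin d}
    (hc : ExpBound a M (c μ ν)) {b : ℝ} (hab : b < a) : AnalyticOnNhd ℂ (f529 c μ ν) (OpenPolyAnnulus d b) :=
  Literature.Analysis.Complex.SCV.analyticOnNhd_tsum_of_summable_norm (isOpen_openPolyAnnulus d b)
    (fun x => differentiableOn_summand_f529 c μ ν x fun z hz κ =>
      norm_pos_iff.mp ((Real.exp_pos _).trans (hz κ).1))
    ((summable_wt (by linarith) d).mul_left M)
    fun x z hz => norm_summand_f529_le hc hz x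

/-- **«The functions f_{μν}(z) are analytic on the polyring ×_μ{e^{−δ₁} < |z_μ| < e^{δ₁}}»** — for a kernel with the
decay (5.10) at rate `a` (`= δ₁`), `f_{μν}` = (5.29) is analytic on the open polyring of width `a`.
[cite: Balaban1987RG1, (5.17) p.294] -/
theorem analyticOnNhd_f529 {a M : ℝ} {c : Fin d → Fin d → Pt d → ℂ} {μ ν : Fin d}
    (hc : ExpBound a M (c μ ν)) : AnalyticOnNhd ℂ (f529 c μ ν) (OpenPolyAnnulus d a) := by
  intro z hz
  obtain ⟨b, hba, hzb⟩ := exists_openPolyAnnulus_lt hz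
  exact analyticOnNhd_f529_of_lt hc hba z hzb

end

end Literature.MathematicalPhysics.QuantumFieldTheory.Balaban1983to89.B12Rep526Analytic
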